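import Mathlib
import HarnessLib
import Literature.Analysis.FluidPDE.SelfSimilar
import Literature.Analysis.FluidPDE.TypeIAncientMild
import Summits.NavierStokesRegularity.NavierStokesRegularity.Theorems.QuarterLogPincerThinCascadeDefs
import Summits.NavierStokesRegularity.NavierStokesRegularity.Theorems.QuarterLogPincerTruncationEdgeShadowing
import Summits.NavierStokesRegularity.NavierStokesRegularity.Theorems.QuarterLogPincerTruncationEdgeAnatomyDefs

/-!
# Crux `QuarterLogPincer.TypeIQuantSubcubicExp` (stmt-NavierStokesRegularity-24077), EDGE line `truncation_edge` (ns-idea-7 g8/g9):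
# piece **P3a `stub_supShadowingCore : StubSupShadowingCore` BY NAME** — the Type-I core of the sup shadowing (polynomial loss)

Prover file (pub-ns-dss typer g35; `--supports stmt-NavierStokesRegularity-24077`, helper).  P3 `SupShadowing` of the line's T1 anatomy
splits (v1.5) as P3a `SupShadowingCore` (the only place where the Type-I RATE enters T1) ∘ P3b `SupShadowingLocal` (localisation;
OPEN).  P3a is proved in the author's workfile by dyadic restart of the tree's `sup_stability_mild_core`; this file gives the importable
Theorems-side discharge BY NAME, read off the typer's polynomial stability estimate `exists_oseenMild_sub_le_of_typeI`
(`…TruncationEdgeOseenStability`, p664453): under the bootstrap hypothesis `‖u − v(·−1)‖ ≤ 2` the Tao-frame solution obeys the drift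
bound `(M+2)/√(1−t)`; both fields are Oseen-mild between every pair of times (`taoFrame_mild_eq`, p666676; `IsTypeIAncientMild.mild_eq`);
hence `‖u(t) − v(t−1)‖_∞ ≤ (K₀/ρ)(2/(1−t))^m ≤ (K₀·2^m/ρ)·ε^{−m}` on `[0,T'] ⊆ [0,1−ε]`, `m = ⌈64C²(M+2)²⌉` (`κ := m`, `K := K₀·2^m`).

HONEST FRAME: a statement about hypothetical objects; P3b, T1, 24077, 22144, W7 and NS regularity OPEN / not proved.
-/

noncomputable section

set_option linter.dupNamespace false

namespace Summit.NavierStokesRegularity.NavierStokesRegularity.Cruxes.TypeIQuantSubcubicExp.TruncationEdge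

open MeasureTheory Set Function Metric Filter Topology Real
open scoped ENNReal NNReal ContDiff
open Literature.Analysis Literature.Analysis.FluidPDE
open Summit.NavierStokesRegularity.NavierStokesRegularity.Cruxes.TypeIQuantSubcubicExp.ThinCascade (TaoFrame)
open Summit.NavierStokesRegularity.NavierStokesRegularity.Theorems.QuarterLogPincerTruncationEdge
  (exists_oseenMild_sub_le_of_typeI taoFrame_mild_eq)

/-! ## P3a by name -/

/-- **P3a BY NAME — `stub_supShadowingCore : StubSupShadowingCore`** (the Type-I core of piece P3 of the T1 anatomy of line
`truncation_edge`, author ns-idea-7 g9; also proved in the author's workfile by dyadic restart of the tree's `sup_stability_mild_core`).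
Here it is read off the typer's importable polynomial stability estimate `exists_oseenMild_sub_le_of_typeI` (p664453): under the
bootstrap hypothesis `‖u − v(·−1)‖ ≤ 2` the frame solution obeys the drift bound `(M+2)/√(1−t)`, both fields are Oseen-mild between every
pair of times (`taoFrame_mild_eq`, p666676; `IsTypeIAncientMild.mild_eq`), so `‖u(t) − v(t−1)‖_∞ ≤ (K₀/ρ)(2/(1−t))^m ≤ (K₀2^m/ρ)·ε^{−m}`,
`m = ⌈64C²(M+2)²⌉`: `κ := m`, `K := K₀·2^m`. [this file; line piece P3a discharged] -/
theorem stub_supShadowingCore : StubSupShadowingCore := by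
  intro M v hv K₀ hK₀
  obtain ⟨C, hC, hTI⟩ := exists_oseenMild_sub_le_of_typeI
  have hM : 0 ≤ M := hv.nonneg
  set m : ℕ := ⌈64 * C ^ 2 * (M + 2) ^ 2⌉₊ with hm
  refine ⟨m, K₀ * 2 ^ m, Nat.cast_nonneg m, by positivity, ?_⟩
  intro ε hε ρ hρ u₀ hu₀ T' hT' u p hu hu0 hclose t ht x
  have hε0 : 0 < ε := hε.1
  have hρ0 : 0 < ρ := by linarith
  have hT'0 : 0 < T' := hT'.1
  have hT'1 : T' < 1 := by linarith [hT'.2]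
  -- the shifted ancient field
  set vb : ℝ → EuclideanSpace ℝ (Fin 3) → EuclideanSpace ℝ (Fin 3) := fun s => v (s - 1) with hvb
  have hvb_cont : ContinuousOn (uncurry vb) (Icc 0 T' ×ˢ univ) := by
    have h1 : ContinuousOn (uncurry v) (Iio 0 ×ˢ univ) := hv.continuousOn_uncurry
    have hφ : Continuous fun q : ℝ × EuclideanSpace ℝ (Fin 3) => (q.1 - 1, q.2) :=
      (continuous_fst.sub continuous_const).prodMk continuous_snd
    refine h1.comp hφ.continuousOn fun q hq => ⟨?_, mem_univ _⟩
    simp only [mem_prod, mem_Icc] at hq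
    show q.1 - 1 < 0
    linarith [hq.1.2]
  have hvb_mild : ∀ s s' : ℝ, 0 ≤ s → s < s' → s' ≤ T' → ∀ y,
      vb s' y = heatFlow (vb s) (s' - s) y - oseenDuhamel 1 s vb vb s' y := by
    intro s s' hs hss' hs' y
    have h := hv.mild_eq (s := s - 1) (t := s' - 1) (by linarith) (by linarith) y
    simp only [hvb]
    rw [h, show s' - 1 - (s - 1) = s' - s by ring, oseenDuhamel_comp_sub_right]
  have hvb_bd : ∀ τ ∈ Icc 0 T', ∀ y, ‖vb τ y‖ ≤ M / Real.sqrt (1 - τ) := by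
    intro τ hτ y
    have := hv.norm_le (t := τ - 1) (by linarith [hτ.2]) y
    simpa [hvb, show -(τ - 1) = 1 - τ by ring] using this
  have hvb_bd' : ∀ τ ∈ Icc 0 T', ∀ y, ‖vb τ y‖ ≤ (M + 2) / Real.sqrt (1 - τ) := fun τ hτ y =>
    (hvb_bd τ hτ y).trans (div_le_div_of_nonneg_right (by linarith) (Real.sqrt_nonneg _))
  -- the frame field under the bootstrap hypothesis
  have hu_cont : ContinuousOn (uncurry u) (Icc 0 T' ×ˢ univ) := hu.1.smooth_velocity.continuousOn
  have hu_mild := taoFrame_mild_eq hu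
  have hu_bd : ∀ τ ∈ Icc 0 T', ∀ y, ‖u τ y‖ ≤ (M + 2) / Real.sqrt (1 - τ) := by
    intro τ hτ y
    have hsq : 0 < Real.sqrt (1 - τ) := Real.sqrt_pos.2 (by linarith [hτ.2])
    have hsq1 : Real.sqrt (1 - τ) ≤ 1 := by rw [Real.sqrt_le_one]; linarith [hτ.1]
    calc ‖u τ y‖ ≤ ‖vb τ y‖ + ‖u τ y - vb τ y‖ := norm_le_insert' _ _
      _ ≤ M / Real.sqrt (1 - τ) + 2 := add_le_add (hvb_bd τ hτ y) (hclose τ hτ y)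
      _ ≤ (M + 2) / Real.sqrt (1 - τ) := by
          rw [add_div]
          refine add_le_add le_rfl ?_
          rw [le_div_iff₀ hsq]; linarith
  have hη : ∀ y, ‖u 0 y - vb 0 y‖ ≤ K₀ / ρ := fun y => by
    simp only [hvb, hu0]; simpa using hu₀ y
  -- the polynomial estimate
  have hmain := hTI (a := 0) (T := T') (T₀ := 1) (M := M + 2) (η := K₀ / ρ) hT'0.le hT'1 hu_cont hvb_cont
    hu_mild hvb_mild (by linarith) hu_bd hvb_bd' hη t ht x
  simp only [sub_zero, mul_one] at hmain
  -- `(2/(1−t))^m ≤ 2^m ε^{−m}`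
  have h1t : ε ≤ 1 - t := by linarith [ht.2, hT'.2]
  have hpow : (2 / (1 - t)) ^ m ≤ (2 : ℝ) ^ m * ε ^ (-(m : ℝ)) := by
    rw [Real.rpow_neg hε0.le, Real.rpow_natCast, ← inv_pow, ← mul_pow]
    refine pow_le_pow_left₀ (div_nonneg zero_le_two (by linarith)) ?_ m
    rw [div_eq_mul_inv]
    exact mul_le_mul_of_nonneg_left ((inv_le_inv₀ (by linarith) hε0).2 h1t) zero_le_two
  calc ‖u t x - v (t - 1) x‖ = ‖u t x - vb t x‖ := by simp only [hvb]
    _ ≤ K₀ / ρ * (2 / (1 - t)) ^ m := hmain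
    _ ≤ K₀ / ρ * ((2 : ℝ) ^ m * ε ^ (-(m : ℝ))) := mul_le_mul_of_nonneg_left hpow (by positivity)
    _ = K₀ * 2 ^ m / ρ * ε ^ (-(m : ℝ)) := by ring

end Summit.NavierStokesRegularity.NavierStokesRegularity.Cruxes.TypeIQuantSubcubicExp.TruncationEdge

end
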